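/-
Copyright (c) 2026. All rights reserved.
Released under Apache 2.0 license as described in the file LICENSE.
Authors: abc-iut cell, wave-6 cone prover seat abc-iut-w6-d025 (gen 4; row «PROP58vii-ARC-GENUINE», file 2/2), over
file 1/2 `MonoAnalyticArchGammaFunctor.lean`, abc-iut-w4-d095's `archGenuine` (`LogFrobeniusLogWallArchOrigin.lean`) and
abc-iut-L4-t3's §5 interface (`LogFrobeniusCompatibility.lean`, `LogFrobeniusMonoAnalyticization.lean`).
-/
import Literature.AnabelianGeometry.AbsoluteAnabelian.MonoAnalyticArchGammaFunctor
import Literature.AnabelianGeometry.AbsoluteAnabelian.TMMonoNonVacuity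
import Literature.AnabelianGeometry.AbsoluteAnabelian.LogFrobeniusLogWallArchOrigin
import Literature.AnabelianGeometry.AbsoluteAnabelian.LogFrobeniusMonoAnalyticization
import HarnessLib

/-!
# [AbsTopIII] Prop 5.8 (vii) at ARCHIMEDEAN places: print's `An⊢[𝒩⊢⊞_w]` (`w ∈ W_arc`) with `Th⊢ ⥲ An⊢` ON THE NOSE,
# the forgetful functors `ψ^{An⊢⊞}_{w,ν}`, `ι^{An⊢⊞}_{w,ε}`, and the §5 setting with GENUINE archimedean An⊢/κ/ψ/ι rows

S. Mochizuki, *Topics in absolute anabelian geometry III*, J. Math. Sci. Univ. Tokyo 22 (2015) [MochizukiAbsTopIII2015];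
manuscript `paper:url-5493eb38cbb7`, read on the page (own render): Prop 5.8 (vii) p. 141 l. 37 – p. 142 l. 9 (for
`w ∈ W_arc`: "Write `An⊢[𝒩⊢⊞_w]` for the category whose objects consist of an object of `Th⊢[Z]`, together with the
object of `Orb(𝒞^{hol⊢}_{TB⊞}[Γ⃗×_arc])` given by applying the algorithm `G ↦ Γ⃗×_arc(G)` of (v) to the object of
`Orb(TM⊢)` obtained by projecting [at `w`] the given object of `Th⊢[Z]`, and whose morphisms are the morphisms induced by
`Th⊢[Z]`. Thus we obtain a natural equivalence of categories `Th⊢[Z] ⥲ An⊢[𝒩⊢⊞_w]` together with a forgetful functor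
`ψ^{An⊢⊞}_{w,ν} : An⊢[𝒩⊢⊞_w] → 𝒩⊢⊞_w` … for each vertex `ν` of `Γ⃗×_w := Γ⃗×_arc`, and a natural transformation
`ι^{An⊢⊞}_{w,ε} : ψ^{An⊢⊞}_{w,ν₁} → ψ^{An⊢⊞}_{w,ν₂}` for each edge `ε`"), Prop 5.8 (iv)/(v) p. 140, Def 5.6 (ii)–(iv)
pp. 135–136, Def 5.4 (v) p. 127 (`Γ⃗^log_v = k∼ →(id) k∼ ↠ k× ↪ k`, so `Γ⃗×_arc = (k∼ ↠ k×)`, vertices `pre`, `mult`).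

## What this file builds (cell row «PROP58vii-ARC-GENUINE», abc-iut-w4-d095's census bricks m3, m4; L4-lead m93/m103)

* §0 `TMMono.ofMulEquiv` — transport of the `TM⊢` structure along a bicontinuous isomorphism of topological monoids
  (pure bookkeeping: `C⃗` by `comap`, `C× × C⃗ ≅ C` by composing homeomorphisms); `TMMono.ulift`; `TMMono.std` = the
  tree's model object `(𝒪^▷_ℂ, ]0,1])` (`TMMono.nonempty_model`, universe `0`) lifted to any universe;
* §1 `TMMono.AnArc` = PRINT'S `An⊢[𝒩⊢⊞_w]` for `w ∈ W_arc`: the category induced along the first projection from pairs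
  `(G, d)`, `d` THE datum `Γ⃗×_arc(G) = (k∼(G) ↠ k×(G))` of file 1/2 (a singleton decoration type — abc-iut-w6-d036's
  `MLFClosure.AnMono` pattern for `w ∈ W_non`); `TMMono.anArcEquiv : TMMono ≌ AnArc` ON THE NOSE (inverse = the
  forgetful functor); `TMMono.arcContainer`, `TMMono.ψArc ν : AnArc ⥤ TMMono × TBPlus` (`ν = pre ↦ k∼`, `ν = mult ↦ k×`;
  over the base on the nose, `ψArc_fst`) and `TMMono.ιArc : ψArc pre ⟶ ψArc mult` along the edge `k∼ ↠ k×`;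
* §2 the §5 setting `LogFrobeniusSetting.archGenuineMonoAn 𝔄 Vmod isArc` := abc-iut-w4-d095's `archGenuine 𝔄` —
  GENUINE holomorphic archimedean rows `λ⊞ = (λ^∼, λ^×)`, `ι⊞ = (id, exp, incl)`, `ℰ• = EA`, `An• = LinHol` — whose
  placeholder mono-analytic side is REPLACED by: `ℰ⊢ := TM⊢`, `𝒩⊢⊞_w = 𝒩⊢_w := TM⊢ × TB⊞`, `An⊢[𝒩⊢⊞] := AnArc`,
  `κ := anArcEquiv`, `ψ^{An⊢⊞}_{w,ν} := ψArc`; theorems: `ψ` IS `ψArc` (`archGenuineMonoAn_ψAnMono`), `ψ` lies over `ℰ⊢` ON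
  THE NOSE (`archGenuineMonoAn_ψOver`), rows 4 → 5 and 6 → 7 commute on the nose (`_monoN_toEmono_eq`, `_κAn₂_monoAn_eq`),
  abc-iut-L4-t3's `MonoAnalyticizationHomotopies` is inhabited, Cor 5.10 (iv)(a) holds for `V(F_mod) ≠ ∅`
  (`archGenuineMonoAn_cor510MonoCores`), Cor 5.5 (iv) sentence 1 still holds (`archGenuineMonoAn_cor55Incompatibility`:
  the holomorphic rows are untouched), and the summary `exists_archGenuineMonoAn`.

HONEST LIMITS (named): (L1) the two mono-analyticization ARROWS — `Th•[Z] → Th⊢[Z]` at `w ∈ W_arc`, i.e. `EA → TM⊢`,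
`𝕏 ↦ (𝒪^▷_{𝒜_𝕏}, 𝒪^▷_{𝒜_𝕏} ∩ ℝ_{>0})` (Def 5.6 (ii)(c)), and `𝒞^hol_{TH} → 𝒞^{hol⊢}_{TB⊞}` (Def 5.6 (iv)) — are NOT
constructed in the tree (abc-iut-L4-t3's `ArchMonoAnalyticization` is an interface; cf. `TMMono.nonempty_degenerate`):
here they are the CONSTANT functors at the standard object `TMMono.std` / `(std, k∼)` — stand-ins, labelled; the
Prop 5.8 (vii) rows (`An⊢`, `κ`, `ψ`, `ι`) and the Prop 5.8 (iv)/(v) functors do not depend on them; successor row: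
`EA ⥤ TM⊢` through the continuous ring automorphisms `e_𝕐 ∘ 𝒜_f ∘ e_𝕏⁻¹ ∈ {id, conj}` of `ℂ` via `TMMono.ofMulEquiv`;
(L2) the nonarchimedean places of this archimedean-only setting read the arc container `k∼` (stand-in; mirror image of
`LogFrobeniusMonoGenuineProp58vii.lean`, where the arc places are the stand-ins); the non-cross vertices `postLog`,
`spaceLink` (no `ψ` in print) also read `k∼`; (L3) `Orb(−)` is read as the identity; (L4) as in file 1/2, ONE chart per
`G` chosen inside the definitions, functoriality PROVED.  MODEL-LEVEL.  Refereed pre-IUT material; nothing here bears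
on [IUTchIII] Cor. 3.12; no side taken; typed ≠ proved elsewhere.
-/

set_option autoImplicit false

noncomputable section

open CategoryTheory Topology

universe w v u

namespace Literature.AnabelianGeometry.AbsoluteAnabelian

/-! ## §0. Transport of the `TM⊢` structure; the standard object at every universe -/

namespace TMMono

variable (M : TMMono.{v})

/-- **Transport of the `TM⊢` structure along a bicontinuous isomorphism of topological monoids `f : C′ ≅ C`**:
`C⃗′ := f⁻¹(C⃗)`, the chart composed with `f`, and `C′× × C⃗′ ≅ C′` by composing homeomorphisms with `C× × C⃗ ≅ C`.
[cite: MochizukiAbsTopIII2015, Def 5.6 (i) p.134] -/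
def ofMulEquiv (C' : Type w) [CommMonoid C'] [TopologicalSpace C'] [ContinuousMul C'] (f : C' ≃* M.C)
    (hf : Continuous f) (hf' : Continuous f.symm) : TMMono.{w} where
  C := C'
  pos := M.pos.comap f.toMonoidHom
  exists_iso := by
    obtain ⟨e, he, he'⟩ := M.exists_iso
    exact ⟨f.trans e, he.comp hf, hf'.comp he'⟩
  isHomeomorph_mul := by
    let fH : C' ≃ₜ M.C := { toEquiv := f.toEquiv, continuous_toFun := hf, continuous_invFun := hf' }
    let uH : C'ˣ ≃ₜ M.Cˣ :=
      { toEquiv := (Units.mapEquiv f).toEquiv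
        continuous_toFun := Continuous.units_map f.toMonoidHom hf
        continuous_invFun := Continuous.units_map f.symm.toMonoidHom hf' }
    let pH : ↥(M.pos.comap f.toMonoidHom) ≃ₜ ↥M.pos :=
      { toFun := fun t => ⟨f t, t.2⟩
        invFun := fun t => ⟨f.symm t, show f.toMonoidHom (f.symm t) ∈ M.pos by
          rw [MulEquiv.coe_toMonoidHom, MulEquiv.apply_symm_apply]; exact t.2⟩
        left_inv := fun t => Subtype.ext (f.symm_apply_apply _)
        right_inv := fun t => Subtype.ext (f.apply_symm_apply _)
        continuous_toFun := (hf.comp continuous_subtype_val).subtype_mk _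
        continuous_invFun := (hf'.comp continuous_subtype_val).subtype_mk _ }
    have key : (fun x : C'ˣ × ↥(M.pos.comap f.toMonoidHom) => (x.1 : C') * (x.2 : C')) =
        fH.symm ∘ (fun y : M.Cˣ × ↥M.pos => (y.1 : M.C) * (y.2 : M.C)) ∘ (uH.prodCongr pH) := by
      funext x
      change (x.1 : C') * (x.2 : C') = f.symm ((Units.map f.toMonoidHom x.1 : M.C) * f x.2)
      rw [Units.coe_map, MulEquiv.coe_toMonoidHom, ← map_mul, MulEquiv.symm_apply_apply]
    rw [key]
    exact fH.symm.isHomeomorph.comp (M.isHomeomorph_mul.comp (uH.prodCongr pH).isHomeomorph)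

/-- The same object of `TM⊢` with its carrier lifted to a larger universe. [cite: MochizukiAbsTopIII2015, Def 5.6 (i) p.134] -/
def ulift : TMMono.{max v w} :=
  M.ofMulEquiv (ULift.{w} M.C) MulEquiv.ulift continuous_uliftDown continuous_uliftUp

/-- **The standard object `(𝒪^▷_ℂ, ]0,1])` of `TM⊢`** (the tree's model `TMMono.nonempty_model` at universe `0`: Def 5.6
(ii)(c) for `𝒜_𝕏 = ℂ`), available at every universe. [cite: MochizukiAbsTopIII2015, Def 5.6 (ii) p.135] -/
def std : TMMono.{w} := (Classical.choice TMMono.nonempty_model).ulift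

/-! ## §1. `An⊢[𝒩⊢⊞_w]` for `w ∈ W_arc`, the equivalence `Th⊢ ⥲ An⊢` on the nose, `ψ^{An⊢⊞}_{w,ν}` and `ι^{An⊢⊞}_{w,ε}` -/

/-- **The `Γ⃗×_arc`-datum of an object of `TM⊢`** — "the object … given by applying the algorithm `G ↦ Γ⃗×_arc(G)` of (v)":
`k∼(G) ↠ k×(G)` (file 1/2: `kTilde`, `kTimes`, `gammaArc`). [cite: MochizukiAbsTopIII2015, Prop 5.8 (vii) p.141] -/
def gammaArcDatum (G : TMMono.{v}) : Σ U : TBPlus.{v}, Σ T : TBPlus.{v}, (U ⟶ T) :=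
  ⟨kTilde.obj G, kTimes.obj G, gammaArc.app G⟩

/-- **`An⊢[𝒩⊢⊞_w]` for `w ∈ W_arc`** (Prop 5.8 (vii), PRINT'S DEFINITION): "the category whose objects consist of an object
of `Th⊢[Z]` [projected at `w`: an object of `Orb(TM⊢)`], together with the object … given by applying the algorithm
`G ↦ Γ⃗×_arc(G)` … and whose morphisms are the morphisms induced by `Th⊢[Z]`" — the category induced along the first
projection from pairs `(G, d)`, `d` THE datum `Γ⃗×_arc(G)`. [cite: MochizukiAbsTopIII2015, Prop 5.8 (vii) p.141] -/
abbrev AnArc : Type (v + 1) :=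
  InducedCategory TMMono.{v}
    (Sigma.fst (β := fun G : TMMono.{v} => {d : Σ U : TBPlus.{v}, Σ T : TBPlus.{v}, (U ⟶ T) // d = gammaArcDatum G}))

/-- **"Thus we obtain a natural equivalence of categories `Th⊢[Z] ⥲ An⊢[𝒩⊢⊞_w]`"** — ON THE NOSE: `G ↦ (G, Γ⃗×_arc(G))`,
`φ ↦ φ`; inverse THE forgetful functor. [cite: MochizukiAbsTopIII2015, Prop 5.8 (vii) p.141] -/
def anArcEquiv : TMMono.{v} ≌ AnArc.{v} :=
  CategoryTheory.Equivalence.mk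
    { obj := fun G => ⟨G, ⟨gammaArcDatum G, rfl⟩⟩
      map := fun f => InducedCategory.homMk f }
    (inducedFunctor _)
    (NatIso.ofComponents (fun G => CategoryTheory.Iso.refl G) fun f =>
      (Category.comp_id f).trans (Category.id_comp f).symm)
    (NatIso.ofComponents (fun X => InducedCategory.isoMk (CategoryTheory.Iso.refl X.1)) fun f =>
      InducedCategory.hom_ext ((Category.comp_id f.hom).trans (Category.id_comp f.hom).symm))

/-- The inverse of the equivalence IS the forgetful functor `(G, d) ↦ G`. [cite: MochizukiAbsTopIII2015, Prop 5.8 (vii) p.141] -/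
theorem anArcEquiv_inverse : anArcEquiv.{v}.inverse = inducedFunctor _ := rfl

/-- The functor of the equivalence decorates `G` with THE datum `Γ⃗×_arc(G)`. [cite: MochizukiAbsTopIII2015, Prop 5.8 (vii) p.141] -/
theorem anArcEquiv_functor_obj (G : TMMono.{v}) : (anArcEquiv.functor.obj G).2.1 = gammaArcDatum G := rfl

/-- The `TB⊞`-containers read at the vertices of `Γ⃗^log_w`: at an ARCHIMEDEAN `w`, `k∼` at the pre-log vertex and `k×` at
the multiplicative vertex (the two vertices of `Γ⃗×_arc`); the post-log / space-link vertices (no `ψ` in print: not in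
`Γ⃗×_w`) and a NONARCHIMEDEAN `w` (no component in this archimedean-only model) read `k∼` — stand-ins, module docstring (L2).
[cite: MochizukiAbsTopIII2015, Prop 5.8 (vii) p.142] -/
def arcContainer : (b : Bool) → LogVertex b → (TMMono.{v} ⥤ TBPlus.{v})
  | true, ArchVertex.mult => kTimes
  | true, ArchVertex.pre => kTilde
  | true, ArchVertex.postLog => kTilde
  | true, ArchVertex.spaceLink => kTilde
  | false, _ => kTilde

/-- **`ψ^{An⊢⊞}_{w,ν} : An⊢[𝒩⊢⊞_w] → 𝒩⊢⊞_w = TM⊢ × TB⊞`** (`w ∈ W_arc`), GENUINE: `(G, Γ⃗) ↦ (G, k∼(G))` at `ν = pre`,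
`(G, Γ⃗) ↦ (G, k×(G))` at `ν = mult`; on morphisms `φ ↦ (φ, (s,t) ↦ (σ_φ s, σ_φ t))`. [cite: MochizukiAbsTopIII2015, Prop 5.8 (vii) p.141] -/
def ψArc (b : Bool) (ν : LogVertex b) : AnArc.{v} ⥤ TMMono.{v} × TBPlus.{v} :=
  inducedFunctor _ ⋙ (𝟭 TMMono.{v}).prod' (arcContainer b ν)

/-- `ψ` lies over the base ON THE NOSE: `ψ_ν ⋙ pr₁ =` the forgetful functor `An⊢ → Th⊢` (the fibred-product leg
`𝒩⊢⊞_w → Th⊢[Z]` of Def 5.6 (iv)). [cite: MochizukiAbsTopIII2015, Definition 5.6 (iv) p.136] -/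
theorem ψArc_fst (b : Bool) (ν : LogVertex b) :
    ψArc.{v} b ν ⋙ CategoryTheory.Prod.fst TMMono.{v} TBPlus.{v} = inducedFunctor _ := rfl

/-- `ψ` at the pre-log vertex `k∼` of an archimedean place reads `k∼(G)` off the decoration.
[cite: MochizukiAbsTopIII2015, Prop 5.8 (vii) p.141] -/
theorem ψArc_pre_obj (X : AnArc.{v}) :
    (ψArc true ArchVertex.pre).obj X = (X.1, kTilde.obj X.1) ∧ X.2.1.1 = kTilde.obj X.1 :=
  ⟨rfl, by rw [X.2.2]; rfl⟩

/-- `ψ` at the multiplicative vertex `k×` of an archimedean place reads `k×(G)` off the decoration.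
[cite: MochizukiAbsTopIII2015, Prop 5.8 (vii) p.141] -/
theorem ψArc_mult_obj (X : AnArc.{v}) :
    (ψArc true ArchVertex.mult).obj X = (X.1, kTimes.obj X.1) ∧ X.2.1.2.1 = kTimes.obj X.1 :=
  ⟨rfl, by rw [X.2.2]; rfl⟩

/-- **`ψ` on a morphism of `Th⊢[Z]`** — an ARBITRARY morphism `φ` of `TM⊢`: the `TB⊞`-component at `k×` acts by the sign
`σ_φ` of the lift of `φ` to the universal coverings. [cite: MochizukiAbsTopIII2015, Prop 5.8 (vii) p.141] -/
theorem ψArc_mult_map_toHom {X Y : AnArc.{v}} (f : X ⟶ Y) (x : TimesCarrier.{v}) :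
    ((ψArc true ArchVertex.mult).map f).2.toHom x = signZ f.hom • x := rfl

/-- **`ι^{An⊢⊞}_{w,ε}` along the edge `k∼ ↠ k×` of `Γ⃗×_arc`**: the natural transformation `ψ_{k∼} ⟶ ψ_{k×}` (identity on
the base, `gammaArc` = covering × identity on the containers). [cite: MochizukiAbsTopIII2015, Prop 5.8 (vii) p.142] -/
def ιArc : ψArc.{v} true ArchVertex.pre ⟶ ψArc.{v} true ArchVertex.mult :=
  Functor.whiskerLeft (inducedFunctor _) (NatTrans.prod' (𝟙 (𝟭 TMMono.{v})) gammaArc)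

/-- `ι^{An⊢⊞}` at `(G, Γ⃗)` IS the arrow `k∼(G) ↠ k×(G)` of the decoration. [cite: MochizukiAbsTopIII2015, Prop 5.8 (vii) p.142] -/
theorem ιArc_app_snd (X : AnArc.{v}) : (ιArc.app X).2 = gammaArc.app X.1 ∧ X.2.1.2.2 ≍ gammaArc.app X.1 :=
  ⟨rfl, by obtain ⟨G, d, hd⟩ := X; subst hd; exact HEq.rfl⟩

end TMMono

/-! ## §2. The §5 setting with GENUINE archimedean `An⊢ / κ / ψ / ι` rows -/

namespace LogFrobeniusSetting

variable (𝔄 : AutHolFieldFunctor.{u})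

/-- **The global log-Frobenius setting with genuine archimedean components on BOTH sides** (module docstring):
abc-iut-w4-d095's `archGenuine 𝔄` (`𝒳 := 𝒞^hol_TF`, `ℰ• := EA`, `An• := LinHol`, archimedean `λ⊞`/`ι⊞` = Def 5.4 (v)'s
graph) with `ℰ⊢ := TM⊢`, `𝒩⊢⊞_w = 𝒩⊢_w := TM⊢ × TB⊞`, `An⊢[𝒩⊢⊞] := AnArc` (print's decorated category), `κ := anArcEquiv`
(on the nose), `ψ^{An⊢⊞}_{w,ν} := ψArc`; the mono-analyticization arrows are the constant stand-ins of (L1).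
[cite: MochizukiAbsTopIII2015, Prop 5.8 (vii) p.141] -/
def archGenuineMonoAn (Vmod : Type (u + 1)) (isArc : Vmod → Bool) : LogFrobeniusSetting Vmod isArc :=
  { archGenuine 𝔄 Vmod isArc with
    Emono := TMMono.{u + 1}
    catEmono := inferInstance
    catNmonoPlus := fun _ => inferInstance
    catNmono := fun _ => inferInstance
    catAnMono := inferInstance
    monoAn := (Functor.const _).obj TMMono.std.{u + 1}
    NmonoPlus := fun _ => TMMono.{u + 1} × TBPlus.{u + 1}
    Nmono := fun _ => TMMono.{u + 1} × TBPlus.{u + 1}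
    forgetMono := fun _ => 𝟭 _
    toEmono := fun _ => CategoryTheory.Prod.fst TMMono.{u + 1} TBPlus.{u + 1}
    monoNplus := fun _ => (Functor.const _).obj (TMMono.std.{u + 1}, TMMono.kTildeObj.{u + 1})
    monoN := fun _ => (Functor.const _).obj (TMMono.std.{u + 1}, TMMono.kTildeObj.{u + 1})
    monoHomotopy := fun _ => Iso.refl _
    AnMono := TMMono.AnArc.{u + 1}
    κAnMono := TMMono.anArcEquiv.{u + 1}
    ψAnMono := fun w ν => TMMono.ψArc (isArc w) ν.1 }

variable (Vmod : Type (u + 1)) (isArc : Vmod → Bool)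

/-- The holomorphic rows are abc-iut-w4-d095's, verbatim: `𝒳 = 𝒞^hol_TF`. [cite: MochizukiAbsTopIII2015, Def 5.4 (v) p.127] -/
theorem archGenuineMonoAn_X : (archGenuineMonoAn 𝔄 Vmod isArc).X = Up (HolTFPair 𝔄) := rfl

/-- … and `λ⊞_{v,ν}` is the genuine archimedean `archLam`. [cite: MochizukiAbsTopIII2015, Def 5.4 (v) p.127] -/
theorem archGenuineMonoAn_lam (v : Vmod) : (archGenuineMonoAn 𝔄 Vmod isArc).lam v = archLam 𝔄 (isArc v) := rfl

/-- **`ψ^{An⊢⊞}_{w,ν}` of the setting IS the genuine `ψArc`** (so `ψArc_pre_obj` / `ψArc_mult_obj` / `ψArc_mult_map_toHom`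
describe it). [cite: MochizukiAbsTopIII2015, Prop 5.8 (vii) p.141] -/
theorem archGenuineMonoAn_ψAnMono (w : Vmod) (ν : {ν : LogVertex (isArc w) // ν.IsCross}) :
    (archGenuineMonoAn 𝔄 Vmod isArc).ψAnMono w ν = TMMono.ψArc (isArc w) ν.1 := rfl

/-- **`ψ^{An⊢⊞}_{w,ν}` lies over `ℰ⊢` ON THE NOSE**: for every `w, ν`, `ψ_ν ⋙ (𝒩⊢⊞_w → 𝒩⊢_w → ℰ⊢) = κ_{An⊢}⁻¹`.
[cite: MochizukiAbsTopIII2015, Definition 5.6 (iv) p.136] -/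
theorem archGenuineMonoAn_ψOver (w : Vmod) (ν : {ν : LogVertex (isArc w) // ν.IsCross}) :
    (archGenuineMonoAn 𝔄 Vmod isArc).ψAnMono w ν ⋙ (archGenuineMonoAn 𝔄 Vmod isArc).forgetMono w ⋙
        (archGenuineMonoAn 𝔄 Vmod isArc).toEmono w =
      (archGenuineMonoAn 𝔄 Vmod isArc).κAnMono.inverse := rfl

/-- rows 4 → 5 ON THE NOSE: `𝒩_v → 𝒩⊢_v → ℰ⊢` and `𝒩_v → ℰ• → ℰ⊢` agree. [cite: MochizukiAbsTopIII2015, Cor 5.10 p. 146] -/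
theorem archGenuineMonoAn_monoN_toEmono_eq (v : Vmod) :
    (archGenuineMonoAn 𝔄 Vmod isArc).monoN v ⋙ (archGenuineMonoAn 𝔄 Vmod isArc).toEmono v =
      (archGenuineMonoAn 𝔄 Vmod isArc).toE v ⋙ (archGenuineMonoAn 𝔄 Vmod isArc).monoAn := rfl

/-- rows 6 → 7 ON THE NOSE (`κ_{An•,2} = κ_{An•}⁻¹` in abc-iut-w4-d095's setting). [cite: MochizukiAbsTopIII2015, Cor 5.10 p. 146] -/
theorem archGenuineMonoAn_κAn₂_monoAn_eq :
    (archGenuineMonoAn 𝔄 Vmod isArc).κAn₂.functor ⋙ (archGenuineMonoAn 𝔄 Vmod isArc).monoAn =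
      (archGenuineMonoAn 𝔄 Vmod isArc).κAn.inverse ⋙ (archGenuineMonoAn 𝔄 Vmod isArc).monoAn := rfl

/-- abc-iut-L4-t3's add-on `MonoAnalyticizationHomotopies` is INHABITED at the setting (`hN` canonical; `anToE` = the unit of
the Prop 5.8 (vii) equivalence). [cite: MochizukiAbsTopIII2015, Cor 5.10 p. 146] -/
def archGenuineMonoAn_monoAnalyticizationHomotopies :
    (archGenuineMonoAn 𝔄 Vmod isArc).MonoAnalyticizationHomotopies where
  toE v := eqToIso (archGenuineMonoAn_monoN_toEmono_eq 𝔄 Vmod isArc v)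
  anToE := Functor.isoWhiskerLeft
    ((archGenuineMonoAn 𝔄 Vmod isArc).κAn.inverse ⋙ (archGenuineMonoAn 𝔄 Vmod isArc).monoAn)
    (archGenuineMonoAn 𝔄 Vmod isArc).κAnMono.unitIso.symm

/-- **[AbsTopIII] Cor 5.10 (iv)(a) HOLDS at the setting** for `V(F_mod) ≠ ∅` (abc-iut-L4-t3's `cor510MonoCores_holds` over the
inhabited add-on). [cite: MochizukiAbsTopIII2015, Cor 5.10 (iv)(a) p.147] -/
theorem archGenuineMonoAn_cor510MonoCores [Nonempty Vmod] : (archGenuineMonoAn 𝔄 Vmod isArc).Cor510MonoCores :=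
  cor510MonoCores_holds (archGenuineMonoAn_monoAnalyticizationHomotopies 𝔄 Vmod isArc)

/-- **Cor 5.5 (iv), sentence 1 (`⊞`-half) STILL HOLDS here** — the holomorphic rows are abc-iut-w4-d095's genuine ones: at an
archimedean `v₀` the arrow `k× ↪ k` misses `0`. [cite: MochizukiAbsTopIII2015, Cor 5.5 (iv) p. 131] -/
theorem archGenuineMonoAn_cor55Incompatibility (v₀ : Vmod) (hv₀ : isArc v₀ = true) (x₀ : Up (HolTFPair 𝔄)) :
    (archGenuineMonoAn 𝔄 Vmod isArc).Cor55Incompatibility :=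
  (archGenuineMonoAn 𝔄 Vmod isArc).cor55Incompatibility_of_iota_spaceLink_not_surjective v₀ hv₀ x₀
    (inducedFunctor _ ⋙ HolTHPair.forget 𝔄)
    (fun ν _ ε => forget_archIota_spaceLink_not_surjective 𝔄 (isArc v₀) hv₀ ν ε x₀)

/-- **Prop 5.8 (vii) at the archimedean places, summary**: a §5 setting over abc-iut-L4-t2's Aut-holomorphic model with
`ℰ⊢ = TM⊢`, `An⊢` print's decorated category, `ψ^{An⊢⊞}` over `ℰ⊢` on the nose, at which Cor 5.10 (iv)(a) holds for
`V(F_mod) ≠ ∅` and Cor 5.5 (iv) sentence 1 holds at every archimedean place. [cite: MochizukiAbsTopIII2015, Prop 5.8 (vii) p.141] -/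
theorem exists_archGenuineMonoAn :
    ∃ L : LogFrobeniusSetting Vmod isArc,
      L.X = Up (HolTFPair 𝔄) ∧ L.Emono = TMMono.{u + 1} ∧ L.AnMono = TMMono.AnArc.{u + 1} ∧
      (∀ w ν, L.ψAnMono w ν ⋙ L.forgetMono w ⋙ L.toEmono w = L.κAnMono.inverse) ∧
      (Nonempty Vmod → L.Cor510MonoCores) ∧
      (∀ v₀, isArc v₀ = true → Nonempty (Up (HolTFPair 𝔄)) → L.Cor55Incompatibility) :=
  ⟨archGenuineMonoAn 𝔄 Vmod isArc, rfl, rfl, rfl, archGenuineMonoAn_ψOver 𝔄 Vmod isArc,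
    fun h => haveI := h; archGenuineMonoAn_cor510MonoCores 𝔄 Vmod isArc,
    fun v₀ hv₀ ⟨x₀⟩ => archGenuineMonoAn_cor55Incompatibility 𝔄 Vmod isArc v₀ hv₀ x₀⟩

end LogFrobeniusSetting

end Literature.AnabelianGeometry.AbsoluteAnabelian

end
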